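import Summits.NavierStokesRegularity.NavierStokesRegularity.Theorems.HubbleDynamoHelicityFluxIdentityTools
import Literature.Analysis.FluidPDE.Superhelicity
import HarnessLib

/-!
# The helicity-flux identity of a Leray profile, III: the boundary term at infinity
# (route `HubbleDynamo`, item `HelicityFluxIdentity`, stmt-NavierStokesRegularity-2060)

All results proved; no definitions, no named facts. For a steady Leray profile
`−νΔU + aU + a(y·∇)U + (U·∇)U + ∇P = 0`, `div U = 0` on `ℝ³` in the Type-I (NRŠ / Chae–Wolf)
decay class `|U| ≤ C/(1+|y|)`, `|∇U| ≤ C/(1+|y|)²`, `|∇Ω| ≤ C/(1+|y|)³` (`Ω = curl U`) with the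
pressure normalised at infinity, `|P| ≤ C/(1+|y|)`, the helicity balance of part I
(`hubbleHelicity_truncated`, cut off with the tree's family `cutoff R`) passes to the limit:

* `hubbleHelicity_flux_tendsto` / `hubbleDynamo_helicityFluxIdentity` — **the identity**

    `a ∫ (y·∇ cutoff R)(y) ⟪U, Ω⟫(y) dy ⟶ 2ν ∫ ⟪Ω, curl Ω⟫ = 2ν · superhelicity U`  (`R → ∞`):

  the helicity exported through the cut-off layer `R ≤ |y| ≤ 2R` by the Hubble flow `a y` (left)
  converges, and its limit is the Ohmic destruction of helicity in the whole space (right; the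
  tree's `Literature.Analysis.FluidPDE.superhelicity`). This settles the point left open when the
  item was filed ("informal until the `R → ∞` boundary term is justified"): of the boundary flux
  `∮_{|y|=R} ⟪F, n⟫`, `F = (½|U|²−P)Ω − ⟪U,Ω⟫(U + a y) − ν (curl Ω) × U`, the terms
  `(½|U|²−P)Ω`, `⟪U,Ω⟫ U`, `ν (curl Ω) × U` are `O((1+|y|)⁻³)` and die against `∇cutoff R = O(1/R)`
  (part II `HubbleDynamoHelicityFluxIdentityTools`: `hubbleHelicity_flux_error_tendsto`,
  dominated convergence with one power of `|y|` to spare, `hubbleHelicity_weight_le`), the two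
  genuinely `O(1)` terms `⟪U,V⟫Ω`, `ΠΩ` of the naive flux have cancelled identically in part I,
  and the one surviving `O(1)` term — Hubble transport
  `−a ⟪U,Ω⟫ y` of the helicity density `h = ⟪U,Ω⟫ = O(|y|⁻³)` — converges BECAUSE the volume
  term does (`⟪Ω, curl Ω⟫ = O((1+|y|)⁻⁵) ∈ L¹`). Its limit is not a Lebesgue integral of `h`
  (which is not integrable in general): along spheres it is `−a lim R³ ∫_{S²} h(Rθ) dθ`, the
  (−3)-homogeneous tail of the helicity density, i.e. a functional of the blow-up trace alone.
* `hubbleHelicity_superhelicity_eq_zero_of_integrable` — rigidity corollary: if the helicity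
  density `⟪U, Ω⟫` IS integrable (e.g. `U = O(|y|^{-1-δ})`), the exported flux vanishes and
  `ν · superhelicity U = 0`.

NOTE on the item. stmt-NavierStokesRegularity-2060 was filed informal (no `def HelicityFluxIdentity`
in the Theses file), so nothing here closes it by name; `hubbleDynamo_helicityFluxIdentity` is
written in the shape of a route decl (hypotheses as in the sibling `DilutionBudget`) as the
candidate signature for the steady case. The `s`-periodic (DSS) case — the same computation
with `∂ₛ⟪U,Ω⟫` added to the balance and a period average — is parts IV–V
(`HubbleDynamoHelicityFluxIdentityEvolution`, `HubbleDynamoHelicityFluxIdentityPeriodic`).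

References: Moffatt 1969 (JFM 35) §§2–3; Berger–Field, J. Fluid Mech. 147 (1984) 133–148
(helicity flux through a boundary); Frisch 1995 (2.24)–(2.29); Tsai 1998 (ARMA 143) §§2, 5;
Nečas–Růžička–Šverák 1996 (decay class); Chae–Wolf, arXiv:1610.09464, Thm 1.1 (decay of DSS
profiles).
-/

noncomputable section

-- D-0017: `<Problem> = <Summit>` by design; the lakefile turns this linter off for `Summits`.
set_option linter.dupNamespace false

open MeasureTheory Set Function Filter Topology InnerProductSpace
open scoped RealInnerProductSpace Laplacian ContDiff

namespace Summit.NavierStokesRegularity.NavierStokesRegularity.Theorems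

open Literature.Analysis.FluidPDE

/-! ### The limit `R → ∞` for a steady profile -/

/-- **The helicity-flux identity of a steady Leray profile (limit form).** For a Leray profile
`−νΔU + aU + a(y·∇)U + (U·∇)U + ∇P = 0`, `div U = 0` on `ℝ³` (`U ∈ C⁴`, `P ∈ C²`) in the Type-I
decay class `|U| ≤ C/(1+|y|)`, `|∇U| ≤ C/(1+|y|)²`, `|∇Ω| ≤ C/(1+|y|)³`, `|P| ≤ C/(1+|y|)`, the
Hubble transport of helicity through the cut-off layer converges to the Ohmic destruction of
helicity in the whole space:

  `a ∫ (y·∇ cutoff R) ⟪U, Ω⟫ dy ⟶ 2ν ∫ ⟪Ω, curl Ω⟫ dy`  as `R → ∞`.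

All three remaining flux terms of `hubbleHelicity_truncated` are `O((1+|y|)⁻³)` paired with
`∇cutoff R` and vanish in the limit (`hubbleHelicity_flux_error_tendsto`), while
`⟪Ω, curl Ω⟫ = O((1+|y|)⁻⁵)` is integrable. In particular the limit on the left EXISTS although
its integrand `h = ⟪U, Ω⟫ = O(|y|⁻³)` is not integrable in general: this is the boundary term at
`R = ∞` of the helicity balance, the helicity exported by the Hubble flow `a y`. -/
theorem hubbleHelicity_flux_tendsto {ν a : ℝ}
    {U : EuclideanSpace ℝ (Fin 3) → EuclideanSpace ℝ (Fin 3)} {P : EuclideanSpace ℝ (Fin 3) → ℝ}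
    (hU : ContDiff ℝ 4 U) (hP : ContDiff ℝ 2 P) (h : IsLerayProfile ν a U P) {C : ℝ}
    (hC : ∀ y, ‖U y‖ ≤ C / (1 + ‖y‖) ∧ ‖fderiv ℝ U y‖ ≤ C / (1 + ‖y‖) ^ 2 ∧
      ‖fderiv ℝ (curl U) y‖ ≤ C / (1 + ‖y‖) ^ 3)
    (hPC : ∀ y, |P y| ≤ C / (1 + ‖y‖)) :
    Tendsto (fun R : ℝ => a * ∫ y, fderiv ℝ (cutoff R) y y * ⟪U y, curl U y⟫) atTop
      (𝓝 (2 * ν * ∫ y, ⟪curl U y, curl (curl U) y⟫)) := by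
  -- regularity
  have hU3 : ContDiff ℝ 3 U := hU.of_le (by norm_num)
  have hU2 : ContDiff ℝ 2 U := hU.of_le (by norm_num)
  have hU1 : ContDiff ℝ 1 U := hU.of_le (by norm_num)
  have hP1 : ContDiff ℝ 1 P := hP.of_le (by norm_num)
  have hΩ2 : ContDiff ℝ 2 (curl U) := contDiff_curl (n := 2) (by exact_mod_cast hU3)
  have hΩ1 : ContDiff ℝ 1 (curl U) := contDiff_curl (n := 1) (by exact_mod_cast hU2)
  have hΞ1 : ContDiff ℝ 1 (curl (curl U)) := contDiff_curl (n := 1) (by exact_mod_cast hΩ2)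
  have cU : Continuous U := hU1.continuous
  have cP : Continuous P := hP1.continuous
  have cΩ : Continuous (curl U) := hΩ1.continuous
  have ch : Continuous (fun z => ⟪U z, curl U z⟫) := cU.inner cΩ
  have cq : Continuous (fun z => ‖U z‖ ^ 2 / 2 - P z) := ((cU.norm.pow 2).div_const 2).sub cP
  -- the four limits
  have l0 := hubbleHelicity_tendsto_integral_cutoff_mul (hubbleHelicity_integrable_ohmic hU3 hC)
  have l1 : Tendsto (fun R : ℝ => ∫ y, fderiv ℝ (cutoff R) y ((‖U y‖ ^ 2 / 2 - P y) • curl U y))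
      atTop (𝓝 0) :=
    hubbleHelicity_flux_error_tendsto (cq.smul cΩ) fun y => (hubbleHelicity_decay_bounds hC hPC y).2.1
  have l2 : Tendsto (fun R : ℝ => ∫ y, fderiv ℝ (cutoff R) y (⟪U y, curl U y⟫ • U y))
      atTop (𝓝 0) :=
    hubbleHelicity_flux_error_tendsto (ch.smul cU) fun y => (hubbleHelicity_decay_bounds hC hPC y).2.2.1
  have l4 : Tendsto (fun R : ℝ => ∫ y, fderiv ℝ (cutoff R) y (cross (curl (curl U) y) (U y)))
      atTop (𝓝 0) :=
    hubbleHelicity_flux_error_tendsto ((hubbleHelicity_contDiff_cross hΞ1 hU1).continuous)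
      fun y => (hubbleHelicity_decay_bounds hC hPC y).2.2.2
  -- assemble along the truncated identity
  have lim := (((l0.const_mul (2 * ν)).add l1).sub l2).sub (l4.const_mul ν)
  simp only [mul_zero, add_zero, sub_zero] at lim
  refine lim.congr' ?_
  filter_upwards [eventually_gt_atTop (0 : ℝ)] with R hR
  exact (hubbleHelicity_truncated hU hP h (contDiff_cutoff (n := 1) R)
    (hasCompactSupport_cutoff hR)).symm

/-! ### The deciding shape and a rigidity corollary -/

/-- **Helicity-flux identity of a steady Leray profile** (route `HubbleDynamo`, item
`HelicityFluxIdentity`, steady case; candidate signature). For a smooth Leray profile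
`−νΔU + aU + a(y·∇)U + (U·∇)U + ∇P = 0`, `div U = 0` on `ℝ³` with Type-I tails
`|U| ≤ C/(1+|y|)`, `|∇U| ≤ C/(1+|y|)²`, `|∇ curl U| ≤ C/(1+|y|)³` and normalised pressure
`|P| ≤ C/(1+|y|)`, the helicity exported to infinity by the Hubble flow equals the Ohmic
destruction of helicity: `a ∫ (y·∇ cutoff R) ⟪U, curl U⟫ → 2ν · superhelicity U` as `R → ∞`
(`superhelicity U = ∫ ⟪curl U, curl curl U⟫`). -/
theorem hubbleDynamo_helicityFluxIdentity (ν a : ℝ)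
    (U : EuclideanSpace ℝ (Fin 3) → EuclideanSpace ℝ (Fin 3)) (P : EuclideanSpace ℝ (Fin 3) → ℝ)
    (hU : ContDiff ℝ (⊤ : ℕ∞) U) (hP : ContDiff ℝ (⊤ : ℕ∞) P) (hprof : IsLerayProfile ν a U P)
    (hdec : ∃ C : ℝ, ∀ y, ‖U y‖ ≤ C / (1 + ‖y‖) ∧ ‖fderiv ℝ U y‖ ≤ C / (1 + ‖y‖) ^ 2 ∧
      ‖fderiv ℝ (curl U) y‖ ≤ C / (1 + ‖y‖) ^ 3 ∧ |P y| ≤ C / (1 + ‖y‖)) :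
    Tendsto (fun R : ℝ => a * ∫ y, fderiv ℝ (cutoff R) y y * ⟪U y, curl U y⟫) atTop
      (𝓝 (2 * ν * superhelicity U)) := by
  obtain ⟨C, hC⟩ := hdec
  rw [superhelicity_eq_integral_inner]
  exact hubbleHelicity_flux_tendsto (hU.of_le (by norm_cast)) (hP.of_le (by norm_cast)) hprof
    (fun y => ⟨(hC y).1, (hC y).2.1, (hC y).2.2.1⟩) fun y => (hC y).2.2.2

/-- **Rigidity corollary.** In the setting of `hubbleDynamo_helicityFluxIdentity`, if the
helicity density `⟪U, curl U⟫` is integrable on `ℝ³` then no helicity is exported to infinity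
(`(y·∇ cutoff R) = O(1)` on the layer and `→ 0` pointwise: dominated convergence), hence the
Ohmic term vanishes: `ν · superhelicity U = 0`. -/
theorem hubbleHelicity_superhelicity_eq_zero_of_integrable (ν a : ℝ)
    (U : EuclideanSpace ℝ (Fin 3) → EuclideanSpace ℝ (Fin 3)) (P : EuclideanSpace ℝ (Fin 3) → ℝ)
    (hU : ContDiff ℝ (⊤ : ℕ∞) U) (hP : ContDiff ℝ (⊤ : ℕ∞) P) (hprof : IsLerayProfile ν a U P)
    (hdec : ∃ C : ℝ, ∀ y, ‖U y‖ ≤ C / (1 + ‖y‖) ∧ ‖fderiv ℝ U y‖ ≤ C / (1 + ‖y‖) ^ 2 ∧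
      ‖fderiv ℝ (curl U) y‖ ≤ C / (1 + ‖y‖) ^ 3 ∧ |P y| ≤ C / (1 + ‖y‖))
    (hint : Integrable fun y => ⟪U y, curl U y⟫) :
    ν * superhelicity U = 0 := by
  have lim := hubbleDynamo_helicityFluxIdentity ν a U P hU hP hprof hdec
  -- the exported flux tends to zero by dominated convergence
  obtain ⟨K, hK0, hK⟩ := exists_norm_fderiv_cutoff_le (E := EuclideanSpace ℝ (Fin 3))
  have lim0 : Tendsto (fun R : ℝ => a * ∫ y, fderiv ℝ (cutoff R) y y * ⟪U y, curl U y⟫) atTop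
      (𝓝 (a * 0)) := by
    refine Tendsto.const_mul a ?_
    have e0 : (0 : ℝ) = ∫ _ : EuclideanSpace ℝ (Fin 3), (0 : ℝ) := by simp
    rw [e0]
    refine tendsto_integral_filter_of_dominated_convergence (fun y => 2 * K * ‖⟪U y, curl U y⟫‖)
      ?_ ?_ (hint.norm.const_mul _) ?_
    · exact Eventually.of_forall fun R =>
        ((((contDiff_cutoff (n := 1) R).continuous_fderiv one_ne_zero).clm_apply
          continuous_id).aestronglyMeasurable).mul hint.aestronglyMeasurable
    · filter_upwards [eventually_gt_atTop (0 : ℝ)] with R hR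
      refine Eventually.of_forall fun y => ?_
      rw [norm_mul, Real.norm_eq_abs]
      exact mul_le_mul_of_nonneg_right (hubbleDilution_cutoff_fderiv_apply_self hR (hK R hR) y)
        (norm_nonneg _)
    · refine Eventually.of_forall fun y => ?_
      refine (tendsto_const_nhds (x := (0 : ℝ))).congr' ?_
      filter_upwards [eventually_gt_atTop ‖y‖, eventually_gt_atTop (0 : ℝ)] with R h1 h2
      rw [hubbleHelicity_fderiv_cutoff_eq_zero_of_lt h2 h1]
      simp
  have huniq := tendsto_nhds_unique lim lim0
  linarith [huniq]

end Summit.NavierStokesRegularity.NavierStokesRegularity.Theorems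

end
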